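import Literature.MathematicalPhysics.QuantumFieldTheory.BalabanImbrieJaffe1984to88.BIJ88Eq5613KineticSources
import Literature.MathematicalPhysics.QuantumFieldTheory.BalabanImbrieJaffe1984to88.BIJ88W1Ineq547Torus
import Literature.MathematicalPhysics.QuantumFieldTheory.BalabanImbrieJaffe1984to88.BIJ88Sect5KernelsAllTori

/-!
# `BalabanImbrieJaffe1984to88.BIJ88Eq5613SourcesTorus` — T. Bałaban, J. Imbrie, A. Jaffe, *Effective action and cluster properties of
the abelian Higgs model*, Commun. Math. Phys. **114** (1988) 257–315 [BalabanImbrieJaffe1988], §5.6 p. 288 [PDF 32] with §5.4 p. 282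
[PDF 26]: **the `w₁`/`w₂` sources of (5.6.13) FED BY NAME from the PROVED row C2.Eq5.4.7 on the tori** — the phase-factor size
`‖e^{ie_k(w₂A′)(x)} − 1‖ ≤ 2e_k·e^{−cr}S₂a` and the `w₁`-phase size `|A′(y,x)| ≤ e_kηN_Γ·e^{−cρ_k}S₁a` of `BIJ88Eq5613KineticSources`
with their `Ineq547` hypothesis DISCHARGED by p08/p02's hypothesis-free torus theorems `BIJ88Sect5KernelsAllTori.ineq547_w2_allTori`
(`w₂ = Λ̄₃(C_{k,loc} − C_k□)`) and `BIJ88W1Ineq547Torus.ineq547_w1_allTori` (`w₁ = w′₁ + H_k□ − H_{k,loc}`, rows in `□₀`).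

statement-level skeleton of published theorems with citation tags; proofs where landed; nothing here is a claim about the Yang–Mills mass gap

CITATION HEADER (lean-in-tree rule).  Part of the lit-balaban TYPED SKELETON (HOME `run/shared/lean/pub/lit-balaban/`), PHASE-2 proof
seat p31 gen 11 (unit `lit-balaban-p31-g11`).  WHAT IS REPRODUCED: row `C2.Eq5.6.13` of `HOME/lit-balaban-r16/ROWS-C2-part2.md`
(owner r16), owner message 2026-08-22T04:21Z: *"open = the sources BY NAME from C2.Eq5.4.7 (PROVED since v2.84 — your F4a p317789 can
feed `ineq547_w1_allTori`/`ineq547_w2_allTori` by name)"*.  Print, p. 288: *"The scalar fields appear with factors e^{ie_kw₂A′} … the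
second term being extremely small. … Any term involving w₁ or w₂ … will be treated separately"*; p. 282 (5.4.7): *"|w₂(x,b)|, |(∂w₁)(p,b)|,
|(∂*w₁)(x,b)| ≦ e^{−cr(e_k)}e^{−c dist(·,b)}"*.
WHAT IS PROVED (0 `sorry`, standard axioms, theorems only).  §1 `abs_contourPhase_le_of_ineq547₂` — the companion's
`abs_contourPhase_le_of_ineq547` with the two bond types of the torus files (`w₁ : B₀ → B_k → ℝ`).  §2 **`norm_phaseFactor_sub_one_le_allTori`**:
ONE `c > 0`, ONE `r₁` such that on EVERY torus of the series, every `k ≤ m + K`, `r ≥ r₁`, `|χ₃| ≤ 1`, column-wise cube, every `A′` with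
`|A′| ≤ a′`, lattice sum `S₂` and `e_k ≥ 0` with `e_k(e^{−cr}S₂)a′ ≤ 1`: `‖phaseFactor e_k w₂ A′ x − 1‖ ≤ 2e_k(e^{−cr}S₂)a′` for THE `w₂` OF
RECORD — `ineq547_w2_allTori` in `BIJ88Eq5613KineticSources.norm_phaseFactor_sub_one_le`.  §3 **`abs_contourPhase_le_allTori`**: ONE
`(c, θ₀, ρ₁)` such that on every torus, `k ≤ m + K`, radius schedule, weights, cube/row functions with the collar clause (all as in
`ineq547_w1_allTori`): `|contourPhase e_kη Γ σ (w₁A′) y x| ≤ e_kηN_Γ(e^{−cρ_k}S₁a′)` for THE `w₁` OF RECORD.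
HONEST SCOPE.  Pure composition: no new analysis; the lattice sums `S₁`, `S₂`, the field bound `a′`, the contour data are hypotheses as in
the companion; the outputs are exactly the `hδ`/`hδ′`-currency inputs of `BIJ88Eq5613KineticSources.ineq5613_kinTot` and
`BIJ88Eq5613Total.ineq5613_total` (with `E = e^{−cr}`).  No `def`, no new named fact; imports the three companions; no Summits import.
Unit `lit-balaban-p31` (literature-prover-lit-balaban-p31-g11-0), 2026-08-22.  NOT summit progress; NOT continuum; NOT Clay.
-/

noncomputable section

open Complex
open scoped BigOperators

namespace Literature.MathematicalPhysics.QuantumFieldTheory.BalabanImbrieJaffe1984to88.BIJ88Eq5613SourcesTorus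

open Balaban1983to89 hiding Site Plaq
open Balaban1983to89.LatticeFieldCalculus
open BIJ85Prop521Torus BIJ85Prop522Torus BIJ85Sect7Statements BIJ85Ineq722Torus
open BIJ88Sect2Statements (loc)
open BIJ88Sect5StatementsPart2 (Ineq547)
open BIJ88Cutoffs21 (cutoff)
open BIJ88W1Prime543Torus (w1P)
open BIJ88Eq220Torus (CkE)
open BIJ88Eq5613KineticSources (contourPhase abs_contourPhase_le phaseFactor norm_phaseFactor_sub_one_le)
open BIJ88W1Ineq547Torus (ineq547_w1_allTori)
open BIJ88Sect5KernelsAllTori (ineq547_w2_allTori)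

open Balaban1983to89 renaming Site → TSite, Plaq → TPlaq

/-! ## §1 The `w₁` feed with two bond types -/

/-- **`|A′(y,x)| ≤ e_kη·N_Γ·(e^{−cr_k}S₁a′)`** from r16's (5.4.7) leaf `Ineq547` for a kernel `w₁ : B₀ → B_k → ℝ` between two bond sets
(unit-lattice bonds carrying the contour, `k`-lattice bonds carrying `A′`) — r16 g8 `BIJ88RotationResidual282.abs_sum_mul_le_of_ineq547`
in the companion's `abs_contourPhase_le`. [cite: BalabanImbrieJaffe1988, (5.4.7) p.282] -/
theorem abs_contourPhase_le_of_ineq547₂ {α β B₀ Bk : Type} [Fintype Bk] {ekη NΓ c rk S₁ a' : ℝ} (hekη : 0 ≤ ekη) (hS₁ : 0 ≤ S₁)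
    (Γ : β → α → Finset B₀) (σ : β → α → B₀ → ℝ) (w₁ : B₀ → Bk → ℝ) (dist : B₀ → Bk → ℝ) (A' : Bk → ℝ)
    (h547 : Ineq547 B₀ Bk w₁ dist c rk) (hS : ∀ b, ∑ b', Real.exp (-(c * dist b b')) ≤ S₁) (hA : ∀ b', |A' b'| ≤ a')
    (ha : 0 ≤ a') {y : β} {x : α} (hσ : ∀ b ∈ Γ y x, |σ y x b| ≤ 1) (hΓ : ((Γ y x).card : ℝ) ≤ NΓ) :
    |contourPhase ekη Γ σ (fun b => ∑ b', w₁ b b' * A' b') y x| ≤ ekη * NΓ * (Real.exp (-(c * rk)) * S₁ * a') :=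
  abs_contourPhase_le hekη (by positivity) Γ σ _ hσ hΓ
    fun b => BIJ88RotationResidual282.abs_sum_mul_le_of_ineq547 w₁ dist A' h547 (hS b) hA ha

/-! ## §2 The phase-factor source on the tori -/

variable {P : Params}

/-- **The phase-factor size FED BY NAME from the proved (5.4.7) for `w₂` on all tori**: with the constants `c > 0`, `r₁` of
`BIJ88Sect5KernelsAllTori.ineq547_w2_allTori` — for every torus of the series (`P.d = d`, `P.L = L`), `k ≤ m + K`, `r ≥ r₁`, `|χ₃| ≤ 1`,
column-wise cube `χ□(b,b) = 1`, and then every `e_k ≥ 0`, field `A′` with `|A′| ≤ a′`, `a′ ≥ 0`, site `x` with lattice sum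
`Σ_b e^{−c·dist(x,b)} ≤ S₂` and `e_k(e^{−cr}S₂)a′ ≤ 1`:
`‖phaseFactor e_k w₂ A′ x − 1‖ ≤ 2e_k(e^{−cr}S₂)a′` for `w₂ = Λ̄₃(C_{k,loc} − C_k□)` of record. [cite: BalabanImbrieJaffe1988, (5.6.13) p.288] -/
theorem norm_phaseFactor_sub_one_le_allTori {d L : ℕ} (hd : 2 ≤ d) (hL : Odd L ∧ 1 < L) {a : ℝ} (ha : 0 < a) :
    ∃ c r₁ : ℝ, 0 < c ∧ ∀ (P : Params) (_ : P.d = d) (_ : P.L = L) (hdP : 2 ≤ P.d) (k : ℕ) (_ : k ≤ P.m + P.K) (r : ℝ), r₁ ≤ r →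
      ∀ (χ₃ : TSite P 0 → ℝ), (∀ x, |χ₃ x| ≤ 1) → ∀ (χb : PBond P k → PBond P k → ℝ), (∀ b, χb b b = 1) →
      ∀ (ek S₂ a' : ℝ) (A' : PBond P k → ℝ), 0 ≤ ek → (∀ b, |A' b| ≤ a') → 0 ≤ a' →
      ∀ (x : TSite P 0), ∑ b : PBond P k, Real.exp (-(c * distEU P k x b.src)) ≤ S₂ → ek * (Real.exp (-(c * r)) * S₂) * a' ≤ 1 →
        ‖phaseFactor ek
            (fun x b =>
              χ₃ x * loc (cutoff (r / 4) (r / 2) fun (x : TSite P 0) (b' : PBond P k) => distEU P k x b'.src)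
                  (fun x b' => CkE P hdP ((P.eta k) ^ P.d) ((P.L : ℝ) ^ k) k (toEj P k (Pi.single b' 1)) x) x b -
                χ₃ x * CkE P hdP ((P.eta k) ^ P.d) ((P.L : ℝ) ^ k) k (toEj P k (Pi.single b 1)) x * χb b b)
            A' x - 1‖ ≤ 2 * ek * (Real.exp (-(c * r)) * S₂) * a' := by
  obtain ⟨c, r₁, hc, h⟩ := ineq547_w2_allTori hd hL ha
  refine ⟨c, r₁, hc, ?_⟩
  intro P hPd hPL hdP k hk r hr χ₃ hχ₃ χb hχb ek S₂ a' A' hek hA ha' x hS hsmall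
  have h547 := h P hPd hPL hdP k hk r hr χ₃ hχ₃ χb hχb
  exact norm_phaseFactor_sub_one_le hek _ _ A' h547 hS hA ha' hsmall

/-! ## §3 The `w₁`-phase source on the tori -/

/-- **The `w₁`-phase size FED BY NAME from the proved (5.4.7) for `w₁` on all tori**: with the constants `(c, θ₀, ρ₁)` of
`BIJ88W1Ineq547Torus.ineq547_w1_allTori` — for every torus, `k ≤ m + K`, radius schedule `ρ` (`ρ_k ≥ ρ₁`, gap `θ₀`), weights `w > 0`,
`c′ ≠ 0`, cube function `|χ□| ≤ 1`, row weight `|χ₀| ≤ 1` with the collar clause, and then every `e_kη ≥ 0`, contour data `Γ`, `σ`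
(`|σ| ≤ 1`, `|Γ_{y,x}| ≤ N_Γ`), field `|A′| ≤ a′`, lattice sums `Σ_{b′}e^{−c dist(b,b′)} ≤ S₁`:
`|contourPhase e_kη Γ σ (w₁A′) y x| ≤ e_kηN_Γ(e^{−cρ_k}S₁a′)` for `w₁ = w′₁ + H_k□ − H_{k,loc}` of record (rows in `□₀`).
[cite: BalabanImbrieJaffe1988, (5.6.13) p.288] -/
theorem abs_contourPhase_le_allTori {α β : Type} {d L : ℕ} (hd : 2 ≤ d) (hL : Odd L ∧ 1 < L) :
    ∃ c θ₀ ρ₁ : ℝ, 0 < c ∧ 0 < θ₀ ∧ 0 < ρ₁ ∧ ∀ (P : Params) (hPd : P.d = d) (_ : P.L = L) (k : ℕ) (_ : k ≤ P.m + P.K) (ρ : ℕ → ℝ),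
      ρ₁ ≤ ρ k → (∀ j < k, ρ k + ((k - j : ℕ) : ℝ) * θ₀ ≤ ρ j) →
      ∀ (c' : ℝ), c' ≠ 0 → ∀ (w : ℝ), 0 < w → ∀ (χb : PBond P k → ℝ), (∀ b', |χb b'| ≤ 1) →
      ∀ (χ₀ : TSite P 0 → ℝ), (∀ x, |χ₀ x| ≤ 1) →
      (∀ (x : TSite P 0) (b' : PBond P k), χ₀ x ≠ 0 → distEU P k x b'.src ≤ ρ k / 8 + 2 → χb b' = 1) →
      ∀ (ekη NΓ S₁ a' : ℝ) (Γ : β → α → Finset (PBond P 0)) (σ : β → α → PBond P 0 → ℝ) (A' : PBond P k → ℝ),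
        0 ≤ ekη → 0 ≤ S₁ → (∀ b : PBond P 0, ∑ b' : PBond P k, Real.exp (-(c * distEU P k b.src b'.src)) ≤ S₁) →
        (∀ b', |A' b'| ≤ a') → 0 ≤ a' → ∀ (y : β) (x : α), (∀ b ∈ Γ y x, |σ y x b| ≤ 1) → ((Γ y x).card : ℝ) ≤ NΓ →
        |contourPhase ekη Γ σ
            (fun b => ∑ b',
              (χ₀ b.src * w1P (hPd ▸ hd) ρ k χb b b' +
                χ₀ b.src * (WithLp.ofLp (HkE P w c' k (toEj P k (Pi.single b' 1))) b * χb b' -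
                  loc (cutoff (ρ k / 16) (ρ k / 8) (fun (b : PBond P 0) (b' : PBond P k) => distEU P k b.src b'.src))
                    (fun b b'' => WithLp.ofLp (HkE P w c' k (toEj P k (Pi.single b'' 1))) b) b b')) * A' b') y x|
          ≤ ekη * NΓ * (Real.exp (-(c * ρ k)) * S₁ * a') := by
  obtain ⟨c, θ₀, ρ₁, hc, hθ₀, hρ₁, h⟩ := ineq547_w1_allTori hd hL
  refine ⟨c, θ₀, ρ₁, hc, hθ₀, hρ₁, ?_⟩
  intro P hPd hPL k hk ρ hρ hgap c' hc' w hw χb hχb χ₀ hχ₀ hcollar ekη NΓ S₁ a' Γ σ A' hekη hS₁ hS hA ha' y x hσ hΓ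
  have h547 := h P hPd hPL k hk ρ hρ hgap c' hc' w hw χb hχb χ₀ hχ₀ hcollar
  exact abs_contourPhase_le_of_ineq547₂ hekη hS₁ Γ σ _ _ A' h547 hS hA ha' hσ hΓ

end Literature.MathematicalPhysics.QuantumFieldTheory.BalabanImbrieJaffe1984to88.BIJ88Eq5613SourcesTorus

end
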